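import Summits.QuantumFields.YangMills.Theorems.PencilRigidityDiagonalMirrorRPRStubRpClosureLattice
import Summits.QuantumFields.YangMills.Theorems.PencilRigidityDiagonalMirrorRPRStubRpClosureSupport
import Summits.QuantumFields.YangMills.Theorems.PencilRigidityDiagonalMirrorRPRStubRpClosureDensity
import Literature.MathematicalPhysics.QuantumLattice.SchwingerOSPositivity
import Summits.QuantumFields.YangMills.Theorems.DiagonalMirrorRPR.Negative.PhantomFunctional

/-!
# Crux `DiagonalMirrorRPR` (stmt-QuantumFields-10604), line `parity-bridge-cold-traces`: the stub `stub_rpClosure`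
# (S4, the OS-limit bookkeeping)

The registered stub `stub_rpClosure : RPClosure`: exact swap-RP of Wilson's measure on the 45° cover `T̃_{N_k}` at
every `k` with `N_k ≥ 2` (`CoverSwapRPAt`, a hypothesis — stub S1) + cover insensitivity of the curvature strings of
compactly supported real test functions (`CoverInsensitivity`, a hypothesis — stub S3) + the curvature package `W₁`
(`CurvaturePackage`: `hconv` on off-diagonal real tensors in all degrees, E0, the proper signed permutations on `⁰𝒮`)
⇒ `S₁` is reflection positive in pull-back form in every diagonal frame `R e₀ = a e₀ + b e₁`, `a² = b² = 1/2`
(`DiagonalFrameRP S₁`).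

Proof (this module, namespace `RpClosure`; helpers in `…StubRpClosureDefs/Lattice/Support/Density`).
* (PSD) in a canonical frame `R e₀ = c (e₀ − e₁)` (`psd_canonical`): for slab-ordered compact real products `P_I` and
  coefficients `c_I`, `∑ c̄_I c_J 𝔖(R·(ΘP_I* ⊗ P_J)) ≥ 0`.  `R·(ΘP_I* ⊗ P_J)` is the off-diagonal real tensor of the
  frame-rotated appended family, so each entry is the limit of the cover Gram matrix `⟨(A_I ∘ θ^*) A_J⟩_k`
  (`hconv` + cover insensitivity; `A_I = ∏_l Φ̃_k(f_{I,l} ∘ R⁻¹)`, the reflected factors being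
  `Φ̃_k((Θf) ∘ R⁻¹) = Φ̃_k(f ∘ R⁻¹) ∘ θ^*` by the key lattice identity; degree `0` by E0 and `⟨1⟩ = 1`); the `A_I`
  eventually live on the closed positive half, so the Gram matrix is Hermitian positive by swap-RP upstairs
  (`stub_rpClosure_latticePSD`), and `[0, ∞) ⊆ ℂ` is closed.
* Every diagonal frame (`psd_frame`): a proper sign flip brings `R` to a canonical frame (`stub_rpClosure_frames`),
  and `𝔖(PR·G) = 𝔖(R·G)` for off-diagonal `G` by the `W(B₄)`-clause of `W₁`.
* Closure (`isReflectionPositive_pullback`, adapted from the tree's `isOSReflectionPositive_of_closure`): the OS form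
  is continuous on `∏ⱼ 𝓢`, the witnesses `H i j` are the concrete tensors, time-ordered test functions are limits of
  combinations of slab-ordered compact real products (`stub_rpClosure_density`), and the form is a non-negative real
  on those by (PSD) in sigma-indexed form (`SchwingerFamily.osPairing_sum_smul`).

References: Osterwalder–Schrader, Comm. Math. Phys. 31 (1973) §2–3 (E2 on `𝒮_<`); Glimm–Jaffe, *Quantum Physics*
§6.1; Fröhlich–Israel–Lieb–Simon, Comm. Math. Phys. 62 (1978) Thm 2.1; Osterwalder–Seiler, Ann. Phys. 110 (1978) §2.
-/

set_option autoImplicit false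

noncomputable section

open scoped SchwartzMap ComplexConjugate InnerProductSpace
open MeasureTheory Filter Topology
open Literature.MathematicalPhysics.QuantumLattice Literature.MathematicalPhysics.AQFT
  Literature.MathematicalPhysics.QuantumFieldTheory

namespace Summit.QuantumFields.YangMills.Cruxes.DiagonalMirrorRPR.ParityBridgeColdTraces

namespace RpClosure

/-! ## §H Positivity of the limiting quadratic form on slab-ordered compact real products -/

section PSD

variable {G : Type} [Group G] [TopologicalSpace G] [IsTopologicalGroup G] [CompactSpace G]
  [MeasurableSpace G] [BorelSpace G]

/-- The pulled-back family `𝔖ₙ ∘ (f ↦ f ∘ R⁻¹)` of the conclusion. -/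
def pullback (S₁ : SchwingerFamily E4) (R : E4 ≃ₗᵢ[ℝ] E4) : SchwingerFamily E4 :=
  fun n => (S₁ n).comp (linActMulti R)

/-- The OS pairing of the pulled-back family. -/
theorem pullback_osPairing {n m : ℕ} (S₁ : SchwingerFamily E4) (R : E4 ≃ₗᵢ[ℝ] E4)
    (A : 𝓢((Fin n → E4), ℂ)) (B : 𝓢((Fin m → E4), ℂ)) :
    (pullback S₁ R).osPairing A B = S₁ (n + m) (linActMulti R ((osAdjoint A).appendTensor B)) := rfl

variable (r : LatticeRep G) (sch : SpeciesScheme (YMSpecies G))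

/-- The smeared, renormalised curvature field `Φ̃_k(h)` on the cover at step `k`. -/
def coverField (k : ℕ) (h : 𝓢(E4, ℝ)) (U : TConfig (2 * sch.side k) (sch.side k) (sch.side k) G) : ℝ :=
  smearedLatticeField r.curvature.F (Literature.Probability.LatticeModels.box 4 (sch.L k)) (sch.a k)
    (sch.c r.curvature k) (sch.m r.curvature k) h (skewLift (sch.side k) U)

/-- `coverSchwinger` in terms of `coverField`. -/
theorem coverSchwinger_eq (k n : ℕ) (f : Fin n → 𝓢(E4, ℝ)) :
    coverSchwinger r sch k n f =
      (texp r.ρ (sch.β k) true fun U => ((∏ i, coverField r sch k (f i) U : ℝ) : ℂ)).re := rfl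

/-- `Φ̃_k(h)` is measurable. -/
theorem measurable_coverField (k : ℕ) (h : 𝓢(E4, ℝ)) : Measurable (coverField r sch k h) :=
  measurable_smearedLatticeField_skewLift _ _ _ _ _ _

/-- `Φ̃_k(h)` is bounded. -/
theorem exists_abs_coverField_le (k : ℕ) (h : 𝓢(E4, ℝ)) : ∃ C : ℝ, ∀ U, |coverField r sch k h U| ≤ C := by
  obtain ⟨C, hC⟩ := exists_abs_smearedLatticeField_le (G := G) r.curvature
    (Literature.Probability.LatticeModels.box 4 (sch.L k)) (sch.a k) (sch.c r.curvature k)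
    (sch.m r.curvature k) h
  exact ⟨C, fun U => hC _⟩

variable {R : E4 ≃ₗᵢ[ℝ] E4} {c : ℝ}

/-- **Key lattice identity in the frame**: `Φ̃_k((Θf) ∘ R⁻¹)(U) = Φ̃_k(f ∘ R⁻¹)(θ^* U)`. -/
theorem coverField_thetaTest (hR : R (ee 0) = c • ee 0 + (-c) • ee 1) (hc : c ^ 2 = 1 / 2) (k : ℕ)
    (f : 𝓢(E4, ℝ)) (U : TConfig (2 * sch.side k) (sch.side k) (sch.side k) G) :
    coverField r sch k (linActTest R (thetaTest 4 f)) U = coverField r sch k (linActTest R f) (swapConfig U) :=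
  smearedLatticeField_swap r _ _ _ _ _ _ (linActTest_thetaTest_apply hR hc f) _ U

omit [Group G] [TopologicalSpace G] [IsTopologicalGroup G] [CompactSpace G] [BorelSpace G] in
/-- A finite product of bounded measurable observables of the positive half is such an observable. -/
theorem prod_observable {N : ℕ} [NeZero N] {n : ℕ} (φ : Fin n → TConfig (2 * N) N N G → ℝ)
    (hm : ∀ l, Measurable (φ l)) (hb : ∀ l, ∃ C : ℝ, ∀ U, |φ l U| ≤ C) :
    Measurable (fun U => ∏ l, φ l U) ∧ ∃ C : ℝ, ∀ U, |∏ l, φ l U| ≤ C := by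
  refine ⟨Finset.measurable_prod _ fun l _ => hm l, ?_⟩
  choose C hC using hb
  refine ⟨∏ l, C l, fun U => ?_⟩
  rw [Finset.abs_prod]
  exact Finset.prod_le_prod (fun l _ => abs_nonneg _) fun l _ => hC l U

omit [Group G] [TopologicalSpace G] [IsTopologicalGroup G] [CompactSpace G] [MeasurableSpace G] [BorelSpace G] in
/-- A finite product of observables of the positive half depends only on the positive half. -/
theorem dependsOn_prod {N : ℕ} [NeZero N] {n : ℕ} (φ : Fin n → TConfig (2 * N) N N G → ℝ)
    (hd : ∀ l, DependsOn (φ l) (posEdges N)) : DependsOn (fun U => ∏ l, φ l U) (posEdges N) :=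
  fun _ _ hUV => Finset.prod_congr rfl fun l _ => hd l hUV

/-- **(PSD) in a canonical frame.** For `R e₀ = c (e₀ − e₁)`, `c = 1/√2`, every finite family of slab-ordered
compact real products `P_I` and coefficients `c_I`: `∑_{I,J} c̄_I c_J 𝔖(R · (Θ P_I* ⊗ P_J)) ≥ 0`. The entries
are limits of the cover Gram matrix (`hconv` + cover insensitivity + the key lattice identity; degree `0` by
E0), which is Hermitian positive by swap-RP upstairs; `[0, ∞) ⊆ ℂ` is closed. -/
theorem psd_canonical (S₁ : SchwingerFamily E4) (hW : CurvaturePackage r sch S₁)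
    (hRP : ∀ k, 2 ≤ sch.side k → CoverSwapRPAt r.ρ (sch.β k) (sch.side k)) (hCI : CoverInsensitivity r sch)
    (hc : c ^ 2 = 1 / 2) (hc0 : 0 < c) (hR : R (ee 0) = c • ee 0 + (-c) • ee 1) {ι : Type} [Fintype ι]
    (deg : ι → ℕ) (P : (I : ι) → 𝓢((Fin (deg I) → E4), ℂ))
    (hP : ∀ I, P I ∈ slabOrderedCompactProducts 4 (deg I)) (coef : ι → ℂ) :
    let z := ∑ I, ∑ J, conj (coef I) * coef J * (pullback S₁ R).osPairing (P I) (P J)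
    0 ≤ z.re ∧ z.im = 0 := by
  intro z
  haveI : SecondCountableTopology G :=
    (r.continuous.isClosedEmbedding r.injective).isEmbedding.secondCountableTopology
  obtain ⟨hconv, ⟨hE0, -, -, -, -, -⟩, -, -, -⟩ := hW
  choose f lo hi hT hlo hle hord hsupp hcs using hP
  obtain ⟨ϱ, hϱ⟩ := exists_radius r.curvature.supp
  -- the lattice observables `A_I^k = ∏_l Φ̃_k(f_{I,l} ∘ R⁻¹)`
  let A : (k : ℕ) → ι → TConfig (2 * sch.side k) (sch.side k) (sch.side k) G → ℝ :=
    fun k I U => ∏ l, coverField r sch k (linActTest R (f I l)) U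
  have hAobs : ∀ k I, Measurable (A k I) ∧ ∃ C : ℝ, ∀ U, |A k I U| ≤ C := fun k I =>
    prod_observable _ (fun l => measurable_coverField r sch k _) fun l => exists_abs_coverField_le r sch k _
  -- eventually they live on the closed positive half
  have hAdep : ∀ᶠ k in atTop, ∀ I, DependsOn (A k I) (posEdges (sch.side k)) := by
    have hev : ∀ I (l : Fin (deg I)), ∀ᶠ k in atTop, sch.a k * (c * (2 * ϱ + 1)) < lo I l ∧
        hi I l < c * sch.a k * (2 * (sch.L k : ℝ) - 2 * ϱ - 1) := fun I l =>
      (eventually_a_mul_lt sch _ (hlo I l)).and (eventually_lt_window sch hc0 ϱ (hi I l))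
    have hev' : ∀ᶠ k in atTop, ∀ I (l : Fin (deg I)), sch.a k * (c * (2 * ϱ + 1)) < lo I l ∧
        hi I l < c * sch.a k * (2 * (sch.L k : ℝ) - 2 * ϱ - 1) :=
      Filter.eventually_all.2 fun I => Filter.eventually_all.2 fun l => hev I l
    filter_upwards [hev'] with k hk I
    refine dependsOn_prod _ fun l => ?_
    exact dependsOn_smearedLatticeField r.curvature hϱ _ _ _ _ _ fun x _ hne =>
      sheared_range_of_ne_zero hR hc0 (hsupp I l) (sch.a_pos k) (hk I l).1 (hk I l).2 x hne
  -- the closed target set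
  let C : Set ℂ := {w | 0 ≤ w.re ∧ w.im = 0}
  have hCcl : IsClosed C :=
    (isClosed_le continuous_const Complex.continuous_re).inter (isClosed_eq Complex.continuous_im continuous_const)
  -- entry convergence
  have hentry : ∀ I J, Tendsto (fun k => texp r.ρ (sch.β k) true
      (fun U => ((A k I (swapConfig U) * A k J U : ℝ) : ℂ))) atTop (𝓝 ((pullback S₁ R).osPairing (P I) (P J))) := by
    intro I J
    -- the real factors of `Θ P_I* ⊗ P_J` and their rotated versions
    let g : Fin (deg I + deg J) → 𝓢(E4, ℝ) := Fin.append (fun i => thetaTest 4 (f I (Fin.rev i))) (f J)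
    let gR : Fin (deg I + deg J) → 𝓢(E4, ℝ) := fun p => linActTest R (g p)
    have hTg : IsTensorOf ((osAdjoint (P I)).appendTensor (P J)) fun p => ofRealTest (g p) :=
      isTensorOf_osAdjoint_appendTensor (hT I) (hT J)
    have hTgR : IsTensorOf (linActMulti R ((osAdjoint (P I)).appendTensor (P J))) fun p => ofRealTest (gR p) :=
      hTg.linActMulti R
    obtain ⟨LO, HI, -, hord', hsupp'⟩ :=
      append_slabs (hlo I) (hle I) (hord I) (hsupp I) (hlo J) (hle J) (hord J) (hsupp J)
    have hoffR : IsOffDiagonal (linActMulti R ((osAdjoint (P I)).appendTensor (P J))) :=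
      isOffDiagonal_linActMulti (isOffDiagonal_of_slabs hTg hord' hsupp') R
    have hcsg : ∀ p, HasCompactSupport (g p : E4 → ℝ) := fun p => by
      induction p using Fin.addCases with
      | left i => simp only [g, Fin.append_left]; exact hasCompactSupport_thetaTest (hcs I _)
      | right j => simp only [g, Fin.append_right]; exact hcs J j
    have hcsR : ∀ p, HasCompactSupport (gR p : E4 → ℝ) := fun p => hasCompactSupport_linActTest (hcsg p) R
    -- the cover Gram entry is the cover Schwinger function of the rotated factors
    have hprod : ∀ k U, ∏ p, coverField r sch k (gR p) U = A k I (swapConfig U) * A k J U := by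
      intro k U
      rw [Fin.prod_univ_add]
      simp only [gR, g, Fin.append_left, Fin.append_right, A]
      congr 1
      simp only [coverField_thetaTest r sch hR hc]
      exact Fintype.prod_equiv Fin.revPerm _ _ fun i => by simp
    have hident : ∀ k, texp r.ρ (sch.β k) true (fun U => ((A k I (swapConfig U) * A k J U : ℝ) : ℂ)) =
        ((coverSchwinger r sch k (deg I + deg J) gR : ℝ) : ℂ) := by
      intro k
      rw [texp_ofReal_eq_re, coverSchwinger_eq]
      simp only [hprod]
    simp only [hident, pullback_osPairing]
    by_cases hn : deg I + deg J = 0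
    · -- degree zero: both sides are `1`
      haveI : IsEmpty (Fin (deg I + deg J)) := by rw [hn]; infer_instance
      have hdI : deg I = 0 := by omega
      have hdJ : deg J = 0 := by omega
      haveI : IsEmpty (Fin (deg I)) := by rw [hdI]; infer_instance
      haveI : IsEmpty (Fin (deg J)) := by rw [hdJ]; infer_instance
      have hlim : S₁ (deg I + deg J) (linActMulti R ((osAdjoint (P I)).appendTensor (P J))) = 1 := by
        have hgen : ∀ {m : ℕ} (hm : m = 0) (F : 𝓢((Fin m → E4), ℂ)) (x : Fin m → E4), S₁ m F = F x := by
          intro m hm F x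
          subst hm
          exact (hE0 (fun _ => ()) F).trans (congrArg F (Subsingleton.elim _ _))
        rw [hgen hn _ (fun _ => 0), hTgR]
        simp
      have hcov : ∀ k, coverSchwinger r sch k (deg I + deg J) gR = 1 := fun k => by
        rw [coverSchwinger_eq]
        simp only [Finset.univ_eq_empty, Finset.prod_empty, Complex.ofReal_one]
        rw [texp_one r.ρ _ _ r.continuous, Complex.one_re]
      simp only [hlim, hcov, Complex.ofReal_one]
      exact tendsto_const_nhds
    · have h1 := hconv (deg I + deg J) hn gR _ hTgR hoffR
      have h2 := hCI (deg I + deg J) hn gR hcsR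
      have h3 : Tendsto (fun k => ((latticeSchwinger r.ρ sch (fun s => s.F) k (deg I + deg J)
          (fun _ => r.curvature) gR : ℝ) : ℂ) - (((latticeSchwinger r.ρ sch (fun s => s.F) k (deg I + deg J)
          (fun _ => r.curvature) gR - coverSchwinger r sch k (deg I + deg J) gR : ℝ)) : ℂ)) atTop
          (𝓝 (S₁ (deg I + deg J) (linActMulti R ((osAdjoint (P I)).appendTensor (P J))) - ((0 : ℝ) : ℂ))) :=
        h1.sub ((Complex.continuous_ofReal.tendsto 0).comp h2)
      simp only [Complex.ofReal_zero, sub_zero] at h3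
      refine h3.congr fun k => ?_
      push_cast
      ring
  -- assembling: the lattice Gram forms converge to `z` and are eventually in `C`
  have hlim : Tendsto (fun k => ∑ I, ∑ J, conj (coef I) * coef J *
      texp r.ρ (sch.β k) true (fun U => ((A k I (swapConfig U) * A k J U : ℝ) : ℂ))) atTop (𝓝 z) :=
    tendsto_finsetSum _ fun I _ => tendsto_finsetSum _ fun J _ => (hentry I J).const_mul _
  have hev : ∀ᶠ k in atTop, (∑ I, ∑ J, conj (coef I) * coef J *
      texp r.ρ (sch.β k) true (fun U => ((A k I (swapConfig U) * A k J U : ℝ) : ℂ))) ∈ C := by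
    filter_upwards [eventually_two_le_side sch, hAdep] with k hk hdep
    exact lattice_psd r (sch.β k) (sch.side k) (hRP k hk) (A k) (fun I => (hAobs k I).1)
      (fun I => (hAobs k I).2) hdep coef
  exact hCcl.mem_of_tendsto hlim hev

end PSD

/-! ## §I Frame reduction and the closure argument -/

section Closure

variable {G : Type} [Group G] [TopologicalSpace G] [IsTopologicalGroup G] [CompactSpace G]
  [MeasurableSpace G] [BorelSpace G] (r : LatticeRep G) (sch : SpeciesScheme (YMSpecies G))
  (S₁ : SchwingerFamily E4)

/-- **(PSD) in every diagonal frame**: reduce `R` to a canonical frame by a proper sign flip `P` (the package's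
`W(B₄)`-invariance on `⁰𝒮`: `𝔖(PR · G) = 𝔖(R · G)` for the off-diagonal `G = Θ P_I* ⊗ P_J`). -/
theorem psd_frame (hW : CurvaturePackage r sch S₁)
    (hRP : ∀ k, 2 ≤ sch.side k → CoverSwapRPAt r.ρ (sch.β k) (sch.side k)) (hCI : CoverInsensitivity r sch)
    {R : E4 ≃ₗᵢ[ℝ] E4} {a b : ℝ} (ha : a ^ 2 = 1 / 2) (hb : b ^ 2 = 1 / 2)
    (hR : R (ee 0) = a • ee 0 + b • ee 1) {ι : Type} [Fintype ι] (deg : ι → ℕ)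
    (P : (I : ι) → 𝓢((Fin (deg I) → E4), ℂ)) (hP : ∀ I, P I ∈ slabOrderedCompactProducts 4 (deg I))
    (coef : ι → ℂ) :
    let z := ∑ I, ∑ J, conj (coef I) * coef J * (pullback S₁ R).osPairing (P I) (P J)
    0 ≤ z.re ∧ z.im = 0 := by
  intro z
  obtain ⟨Pf, c, hc, hc0, hdet, hsigned, hR'⟩ := frame_normal_form ha hb hR
  have hrot := hW.2.2.2.1
  have hterm : ∀ I J, (pullback S₁ R).osPairing (P I) (P J) =
      (pullback S₁ (R.trans Pf)).osPairing (P I) (P J) := by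
    intro I J
    obtain ⟨fI, loI, hiI, hTI, hloI, hleI, hordI, hsuppI, -⟩ := hP I
    obtain ⟨fJ, loJ, hiJ, hTJ, hloJ, hleJ, hordJ, hsuppJ, -⟩ := hP J
    obtain ⟨LO, HI, -, hord', hsupp'⟩ := append_slabs hloI hleI hordI hsuppI hloJ hleJ hordJ hsuppJ
    have hoff : IsOffDiagonal ((osAdjoint (P I)).appendTensor (P J)) :=
      isOffDiagonal_of_slabs (isTensorOf_osAdjoint_appendTensor hTI hTJ) hord' hsupp'
    rw [pullback_osPairing, pullback_osPairing,
      ← Summit.QuantumFields.YangMills.Theorems.DiagonalMirrorRPR.Negative.Phantom.linActMulti_linActMulti Pf R,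
      hrot Pf hdet hsigned _ _ (isOffDiagonal_linActMulti hoff R)]
  simp only [z, hterm]
  exact psd_canonical r sch S₁ hW hRP hCI hc hc0 hR' deg P hP coef

/-- **The closure step.** Exact swap-RP upstairs + cover insensitivity + `hconv` + E0 + continuity + the density
of slab-ordered compact real products in the time-ordered test functions ⇒ the pulled-back family is
reflection positive (E2) in the diagonal frame `R`. -/
theorem isReflectionPositive_pullback (hW : CurvaturePackage r sch S₁)
    (hRP : ∀ k, 2 ≤ sch.side k → CoverSwapRPAt r.ρ (sch.β k) (sch.side k)) (hCI : CoverInsensitivity r sch)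
    {R : E4 ≃ₗᵢ[ℝ] E4} {a b : ℝ} (ha : a ^ 2 = 1 / 2) (hb : b ^ 2 = 1 / 2)
    (hR : R (ee 0) = a • ee 0 + b • ee 1) :
    (SchwingerFamily.toLabelled (fun n => (S₁ n).comp (linActMulti R))).IsReflectionPositive := by
  -- adapted from `IsSchwingerFamilyOf.isOSReflectionPositive_of_closure`
  -- (Literature/QuantumLattice/SchwingerOSPositivity): the same closure argument, with `psd_frame` as input
  intro N deg lab F hF H hH z
  let S : SchwingerFamily E4 := pullback S₁ R
  let Φ : ((j : Fin N) → 𝓢((Fin (deg j) → E4), ℂ)) → ℂ := fun G => ∑ i, ∑ j, S.osPairing (G i) (G j)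
  have hΦ : Continuous Φ := by
    refine continuous_finsetSum _ fun i _ => continuous_finsetSum _ fun j _ => ?_
    exact continuous_iff_continuousAt.2 fun G =>
      S.tendsto_osPairing ((continuous_apply i).tendsto G) ((continuous_apply j).tendsto G)
  let C : Set ℂ := {w | 0 ≤ w.re ∧ w.im = 0}
  have hC : IsClosed C :=
    (isClosed_le continuous_const Complex.continuous_re).inter
      (isClosed_eq Complex.continuous_im continuous_const)
  let A : Set ((j : Fin N) → 𝓢((Fin (deg j) → E4), ℂ)) :=
    Set.pi Set.univ fun j => (Submodule.span ℂ (slabOrderedCompactProducts 4 (deg j)) : Set _)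
  have hA : A ⊆ Φ ⁻¹' C := by
    intro G hG
    have hrep : ∀ j : Fin N, ∃ (k : ℕ) (cf : Fin k → ℂ) (v : Fin k → slabOrderedCompactProducts 4 (deg j)),
        ∑ i, cf i • (v i : 𝓢((Fin (deg j) → E4), ℂ)) = G j :=
      fun j => Submodule.mem_span_set'.1 (hG j (Set.mem_univ j))
    choose k cf v hv using hrep
    have key := psd_frame r sch S₁ hW hRP hCI ha hb hR (ι := Σ j : Fin N, Fin (k j))
      (fun p => deg p.1) (fun p => (v p.1 p.2 : 𝓢((Fin (deg p.1) → E4), ℂ))) (fun p => (v p.1 p.2).2)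
      (fun p => cf p.1 p.2)
    have hΦG : Φ G = ∑ p : (Σ j : Fin N, Fin (k j)), ∑ q : (Σ j : Fin N, Fin (k j)),
        conj (cf p.1 p.2) * cf q.1 q.2 *
          S.osPairing (v p.1 p.2 : 𝓢((Fin (deg p.1) → E4), ℂ)) (v q.1 q.2 : 𝓢((Fin (deg q.1) → E4), ℂ)) := by
      simp only [Φ, ← hv]
      simp only [Fintype.sum_sigma]
      refine Finset.sum_congr rfl fun n _ => ?_
      rw [Finset.sum_comm]
      refine Finset.sum_congr rfl fun m _ => ?_
      have := S.osPairing_sum_smul Finset.univ Finset.univ (cf n) (cf m)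
        (fun i => (v n i : 𝓢((Fin (deg n) → E4), ℂ))) (fun i => (v m i : 𝓢((Fin (deg m) → E4), ℂ)))
      rw [this]
    show Φ G ∈ C
    rw [hΦG]
    exact key
  have hcl : closure A ⊆ Φ ⁻¹' C := (hC.preimage hΦ).closure_subset_iff.2 hA
  have hFmem : (fun j : Fin N => F j) ∈ closure A := by
    rw [closure_pi_set]
    exact fun j _ => mem_closure_span_slabOrderedCompactProducts (hF j)
  have hres : Φ (fun j => F j) ∈ C := hcl hFmem
  have hz : z = Φ (fun j => F j) := by
    simp only [z, Φ, SchwingerFamily.toLabelled_apply]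
    refine Finset.sum_congr rfl fun i _ => Finset.sum_congr rfl fun j _ => ?_
    exact S.osPairing_eq_of_isAppendTensorOf (hH i j)
  rw [hz]
  exact hres

end Closure

end RpClosure

/-- **S4 (M), `stub_rpClosure`.** Closure: exact RP upstairs (`CoverSwapRPAt` at `N_k ≥ 2`) + cover
insensitivity + `hconv` (all degrees, test function by test function) + E0 (degree `0`) + continuity of `S₁ n` +
density of finite sums of off-diagonal REAL tensors with compact support in the rotated wedge classes ⇒
`DiagonalFrameRP S₁`.  Bookkeeping: the curvature observable is swap-invariant, so `Φ_a(f)(θ^*U) = Φ_a(f ∘ σ)(U)`;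
a compact support in `{x₀ > x₁}` lies in the closed positive half of `T̃_{N_k}` for large `k`; the mirrors
`x₀ = −x₁` reduce to `x₀ = x₁` by a proper signed permutation in `W₁`; the frame enters only through `R e₀`. -/
theorem stub_rpClosure :
    ∀ (G : Type) [Group G] [TopologicalSpace G] [IsTopologicalGroup G] [CompactSpace G]
      [MeasurableSpace G] [BorelSpace G], IsCompactSimpleLieGroup G →
      ∀ (r : LatticeRep G) (sch : SpeciesScheme (YMSpecies G)) (S₁ : SchwingerFamily E4),
        CurvaturePackage r sch S₁ → (∀ k, 0 ≤ sch.β k) →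
          (∀ k, 2 ≤ sch.side k → CoverSwapRPAt r.ρ (sch.β k) (sch.side k)) →
            CoverInsensitivity r sch → DiagonalFrameRP S₁ := by
  intro G _ _ _ _ _ _ _hG r sch S₁ hW _hβ hRP hCI R a b ha hb hR
  exact RpClosure.isReflectionPositive_pullback r sch S₁ hW hRP hCI ha hb hR

/-- The registered short form `RPClosure` holds. -/
theorem RpClosure.rpClosure : RPClosure := stub_rpClosure

end Summit.QuantumFields.YangMills.Cruxes.DiagonalMirrorRPR.ParityBridgeColdTraces

end
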